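import Summits.CriticalPhenomena.PercolationContinuityZ3.Theorems.PercNearOneGluingNoHeavyLowerTailStarSetResidualLedgerRDisjointA
import Summits.CriticalPhenomena.PercolationContinuityZ3.Theorems.PercNearOneGluingNoHeavyLowerTailStarSetResidualLedgerRDisjointB
import Summits.CriticalPhenomena.PercolationContinuityZ3.Theorems.PercNearOneGluingNoHeavyLowerTailStarSetResidualShapes
import HarnessLib

/-!
# `NoHeavyLowerTail` (stmt-CriticalPhenomena-4575) — the residual ledger, III: the r-class word families (U1-PROOF.md §9; blueprint §G4)

Support file (prover `prim-gen-swap` gen 15; `--supports stmt-CriticalPhenomena-4575`).  No definitions, no named facts, no sorries.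

The five word families of the residual bound filed under class-sets with a class through `r` (R1-rider `{X, I₀, ρ}`, SELF
`{X, J, dom X ē}`, SELF′ `{X, J, I₀}`, SELF_I `{X, I₀, dom X a}`, CROSS_I `{X, Y, I₀}`) are pairwise disjoint
(`residual_rwords_disjoint_R1`, `residual_rwords_disjoint_pool`), and a class-set with a class through `r` is neither an r-free
triangle nor a regular triple (`not_tri_of_r_mem`, `not_rsh_of_r_mem`); so with coefficient `1` each they are paid by
`Σ_{T ∉ TRIS ∪ REGT, T has a class through r} C_T`.

* `StarSet.residual_rwords_bound`.
-/

namespace Summit.CriticalPhenomena.PercolationContinuityZ3.Theorems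

open Finset
open scoped BigOperators Classical

namespace StarSet

variable {ι V : Type*} [Fintype ι] [LinearOrder ι] [DecidableEq V]

/-- **The r-class word families of the residual bound are paid by the non-triangle non-regular class-sets with a class through `r`.**  See the file header. -/
theorem residual_rwords_bound (P P' : ι → V) (hPP' : ∀ X, P X ≠ P' X)
    (hinj : Function.Injective fun X => (s(P X, P' X) : Sym2 V)) (r : V) (F : Finset ι)
    (dom : ι → V → ι)
    (hdom : ∀ X ∉ F, ∀ d, (P X = d ∨ P' X = d) →
      dom X d ∈ F ∧ (P (dom X d) = d ∨ P' (dom X d) = d) ∧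
        (∀ u, (P (dom X d) = u ∨ P' (dom X d) = u) → (P X = u ∨ P' X = u) → u = d))
    (I₀ : ι) (hleaf : ∀ I ∈ F, P' I = r → I = I₀) (hI₀r : I₀ ∈ F → P' I₀ = r)
    (U : Finset (Finset ι × ι)) (Jf : Finset ι × ι → ι) (ef ēf : Finset ι × ι → V) (ρf : Finset ι × ι → ι)
    (hdata : (∀ u ∈ U, u.2 ∈ u.1 ∧ u.2 ∉ F ∧ (P u.2 ≠ r ∧ P' u.2 ≠ r) ∧
      (∀ Y ∈ u.1, P Y = P u.2 ∨ P Y = P' u.2 ∨ P' Y = P u.2 ∨ P' Y = P' u.2) ∧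
      ¬ ((∀ I ∈ F, I ∉ u.1) ∨ ∃ a ∈ F, P a = r ∧ a ∈ u.1 ∧ ∀ b ∈ F, b < a → b ∉ u.1) ∧
      Jf u ∈ u.1 ∧ Jf u ∈ F ∧ (∀ I ∈ u.1, I ∈ F → Jf u ≤ I) ∧ P (Jf u) ≠ r ∧
      ((P u.2 = ef u ∧ P' u.2 = ēf u) ∨ (P u.2 = ēf u ∧ P' u.2 = ef u)) ∧ (P (Jf u) = ef u ∨ P' (Jf u) = ef u) ∧
      ¬ (P (Jf u) = ēf u ∨ P' (Jf u) = ēf u) ∧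
      ((P (Jf u) = ef u ∧ P' (Jf u) = r ∧ P (dom u.2 (ēf u)) ≠ r ∧ P' (dom u.2 (ēf u)) ≠ r) ∨
       (P (Jf u) ≠ r ∧ P' (Jf u) ≠ r ∧
        ((P (dom u.2 (ēf u)) = r ∧ P' (dom u.2 (ēf u)) = ēf u ∧ Jf u < dom u.2 (ēf u)) ∨
         (P (dom u.2 (ēf u)) = ēf u ∧ P' (dom u.2 (ēf u)) = r)))) ∧
      (∀ Y ∈ u.1, Y ≠ u.2 → (P Y ≠ r ∧ P' Y ≠ r) → ∀ p, (P u.2 = p ∨ P' u.2 = p) → (P Y ≠ p ∧ P' Y ≠ p) →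
        (P (dom u.2 p) = r ∨ P' (dom u.2 p) = r))))
    (hρ : (∀ u ∈ U, (((u.1.erase u.2).erase (Jf u)).filter (fun K => (P K ≠ r ∧ P' K ≠ r) ∧ K ≠ dom u.2 (ēf u))).Nonempty → ρf u ∈
        (((u.1.erase u.2).erase (Jf u)).filter (fun K => (P K ≠ r ∧ P' K ≠ r) ∧ K ≠ dom u.2 (ēf u)))))
    (UR1 UG UC UH : Finset (Finset ι × ι))
    (hUR1 : UR1 = U.filter (fun u => (P (Jf u) = ef u ∧ P' (Jf u) = r) ∧ (((u.1.erase u.2).erase (Jf u)).filter (fun K => (P K ≠ r ∧ P' K ≠ r) ∧ K ≠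
        dom u.2 (ēf u))).Nonempty))
    (hUG : UG = U.filter (fun u => ¬ (P (Jf u) = ef u ∧ P' (Jf u) = r) ∧ ¬ (¬ (P (Jf u) = ef u ∧ P' (Jf u) = r) ∧ dom u.2 (ef u) ≠ Jf u ∧ (P (dom
        u.2 (ef u)) ≠ r ∧ P' (dom u.2 (ef u)) ≠ r)) ∧ ¬ (((u.1.erase u.2).erase (Jf u)).filter (fun K => (P K ≠ r ∧ P' K ≠ r) ∧ K
        ≠ dom u.2 (ēf u))).Nonempty ∧ ¬ (P' (dom u.2 (ēf u)) = r ∧ Jf u = dom u.2 (ef u))))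
    (hUC : UC = U.filter (fun u => (P (Jf u) = ef u ∧ P' (Jf u) = r) ∧ ¬ (((u.1.erase u.2).erase (Jf u)).filter (fun K => (P K ≠ r ∧ P' K ≠ r) ∧ K
        ≠ dom u.2 (ēf u))).Nonempty ∧ dom u.2 (ef u) ≠ Jf u))
    (hUH : UH = U.filter (fun u => ¬ (((u.1.erase u.2).erase (Jf u)).filter (fun K => (P K ≠ r ∧ P' K ≠ r) ∧ K ≠ dom u.2 (ēf u))).Nonempty ∧ (((P
        (Jf u) = ef u ∧ P' (Jf u) = r) ∧ dom u.2 (ef u) = Jf u) ∨ (¬ (P (Jf u) = ef u ∧ P' (Jf u) = r) ∧ ¬ (¬ (P (Jf u) = ef u ∧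
        P' (Jf u) = r) ∧ dom u.2 (ef u) ≠ Jf u ∧ (P (dom u.2 (ef u)) ≠ r ∧ P' (dom u.2 (ef u)) ≠ r)) ∧ (P' (dom u.2 (ēf u)) = r ∧
        Jf u = dom u.2 (ef u))))))
    (TRIS REGT : Finset (Finset ι))
    (hTRIS : ∀ T, T ∈ TRIS ↔ ∃ (a b c : V) (X Y Z : ι), a ≠ b ∧ a ≠ c ∧ b ≠ c ∧ a ≠ r ∧ b ≠ r ∧ c ≠ r ∧
        (s(P X, P' X) : Sym2 V) = s(a, b) ∧ (s(P Y, P' Y) : Sym2 V) = s(a, c) ∧ (s(P Z, P' Z) : Sym2 V) = s(b, c) ∧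
        T = {X, Y, Z})
    (hREGT : ∀ T, T ∈ REGT ↔ ∃ (M E₁ E₂ : ι) (q₁ q₂ f₁ f₂ : V),
          M ∉ F ∧ (s(P M, P' M) : Sym2 V) = s(q₁, q₂) ∧ (s(P E₁, P' E₁) : Sym2 V) = s(q₁, f₁) ∧
          (s(P E₂, P' E₂) : Sym2 V) = s(q₂, f₂) ∧ q₁ ≠ q₂ ∧ f₁ ≠ q₁ ∧ f₁ ≠ q₂ ∧ f₂ ≠ q₁ ∧ f₂ ≠ q₂ ∧
          q₁ ≠ r ∧ q₂ ≠ r ∧ f₁ ≠ r ∧ f₂ ≠ r ∧ T = {M, E₁, E₂})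
    (C : Finset ι → ℝ) (hC0 : ∀ T, 0 ≤ C T) :
    ∑ T ∈ (UR1.image (fun u => ({u.2, I₀, ρf u} : Finset ι))), C T +
      ∑ T ∈ (UG.image (fun u => ({u.2, Jf u, dom u.2 (ēf u)} : Finset ι))), C T +
      ∑ T ∈ ((UG.filter (fun u => (((P u.2 = P I₀ ∨ P' u.2 = P I₀) ∧ I₀ ∈ F ∧ P' I₀ = r) ∧ dom u.2 (ēf u) ≠ I₀))).image (fun u => ({u.2, Jf u, I₀} : Finset ι))), C T +
      ∑ T ∈ ((UC ∪ UH).image (fun u => ({u.2, I₀, dom u.2 (if P u.2 = P I₀ then P' u.2 else P u.2)} : Finset ι))), C T +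
      ∑ T ∈ ((((UC ∪ UH).image Prod.snd ×ˢ (UC ∪ UH).image Prod.snd).filter (fun p => p.1 < p.2)).image (fun p => ({p.1, p.2, I₀} : Finset ι))), C T ≤
      ∑ T ∈ ((univ : Finset ι).powerset.filter (fun T => T ∉ TRIS ∧ T ∉ REGT)).filter
          (fun T => ∃ K ∈ T, P K = r ∨ P' K = r), C T := by
  obtain ⟨d12, d13, d14, d15⟩ := residual_rwords_disjoint_R1 P P' hPP' hinj r F dom hdom I₀ hleaf hI₀r U Jf ef ēf ρf hdata hρ
    UR1 UG UC UH hUR1 hUG hUC hUH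
  obtain ⟨d23, d24, d25, d34, d35, d45⟩ := residual_rwords_disjoint_pool P P' hPP' hinj r F dom hdom I₀ hleaf hI₀r U Jf ef ēf ρf
    hdata hρ UG UC UH hUG hUC hUH
  have facts := residual_unit_facts P P' hPP' hinj r F dom hdom I₀ hleaf hI₀r U Jf ef ēf ρf hdata hρ
  set A1 := UR1.image (fun u => ({u.2, I₀, ρf u} : Finset ι)) with hA1
  set A2 := UG.image (fun u => ({u.2, Jf u, dom u.2 (ēf u)} : Finset ι)) with hA2
  set A3 := (UG.filter (fun u => (((P u.2 = P I₀ ∨ P' u.2 = P I₀) ∧ I₀ ∈ F ∧ P' I₀ = r) ∧ dom u.2 (ēf u) ≠ I₀))).image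
    (fun u => ({u.2, Jf u, I₀} : Finset ι)) with hA3
  set A4 := (UC ∪ UH).image (fun u => ({u.2, I₀, dom u.2 (if P u.2 = P I₀ then P' u.2 else P u.2)} : Finset ι)) with hA4
  set A5 := (((UC ∪ UH).image Prod.snd ×ˢ (UC ∪ UH).image Prod.snd).filter (fun p => p.1 < p.2)).image
    (fun p => ({p.1, p.2, I₀} : Finset ι)) with hA5
  -- the leaf class of an `I₀`-unit
  have hI' : ∀ w ∈ UC ∪ UH, P' I₀ = r := by
    intro w hw
    rcases mem_union.1 hw with hw | hw
    · rw [hUC, mem_filter] at hw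
      obtain ⟨hwU, h1, -⟩ := hw
      obtain ⟨-, -, -, -, -, -, -, -, -, hon, -⟩ := facts w hwU
      exact (hon h1).2.2.2.1
    · rw [hUH, mem_filter] at hw
      obtain ⟨hwU, -, hcase⟩ := hw
      obtain ⟨-, -, -, -, -, -, -, -, -, hon, -, hbundle, -⟩ := facts w hwU
      rcases hcase with ⟨h1, -⟩ | ⟨hn1, -, hb1, hb2⟩
      · exact (hon h1).2.2.2.1
      · exact (hbundle ⟨hn1, hb1, hb2⟩).2.2.1
  -- every class-set of the five families has a class through `r`
  have hr : ∀ T ∈ A1 ∪ A2 ∪ A3 ∪ A4 ∪ A5, ∃ K ∈ T, P K = r ∨ P' K = r := by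
    intro T hT
    simp only [mem_union] at hT
    rcases hT with (((hT | hT) | hT) | hT) | hT
    · obtain ⟨u, hu, rfl⟩ := mem_image.1 hT
      rw [hUR1, mem_filter] at hu
      obtain ⟨-, -, -, -, -, -, -, -, -, hon, -⟩ := facts u hu.1
      exact ⟨I₀, by simp, Or.inr (hon hu.2.1).2.2.2.1⟩
    · obtain ⟨v, hv, rfl⟩ := mem_image.1 hT
      rw [hUG, mem_filter] at hv
      obtain ⟨-, -, -, -, -, -, -, -, hoff, -⟩ := facts v hv.1
      exact ⟨dom v.2 (ēf v), by simp, (hoff hv.2.1).2.1⟩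
    · obtain ⟨v, hv, rfl⟩ := mem_image.1 hT
      obtain ⟨-, ⟨-, -, hIr⟩, -⟩ := mem_filter.1 hv
      exact ⟨I₀, by simp, Or.inr hIr⟩
    · obtain ⟨w, hw, rfl⟩ := mem_image.1 hT
      exact ⟨I₀, by simp, Or.inr (hI' w hw)⟩
    · obtain ⟨p, hp, rfl⟩ := mem_image.1 hT
      obtain ⟨hp, -⟩ := mem_filter.1 hp
      obtain ⟨h1, -⟩ := mem_product.1 hp
      obtain ⟨w, hw, -⟩ := mem_image.1 h1
      exact ⟨I₀, by simp, Or.inr (hI' w hw)⟩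
  have hsub : A1 ∪ A2 ∪ A3 ∪ A4 ∪ A5 ⊆ ((univ : Finset ι).powerset.filter (fun T => T ∉ TRIS ∧ T ∉ REGT)).filter
      (fun T => ∃ K ∈ T, P K = r ∨ P' K = r) := by
    intro T hT
    have hK := hr T hT
    exact mem_filter.2 ⟨mem_filter.2 ⟨mem_powerset.2 (subset_univ _), fun h => not_tri_of_r_mem P P' r T hK ((hTRIS T).1 h),
      fun h => not_rsh_of_r_mem P P' r F T hK ((hREGT T).1 h)⟩, hK⟩
  have hunion : ∑ T ∈ A1 ∪ A2 ∪ A3 ∪ A4 ∪ A5, C T =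
      ∑ T ∈ A1, C T + ∑ T ∈ A2, C T + ∑ T ∈ A3, C T + ∑ T ∈ A4, C T + ∑ T ∈ A5, C T := by
    rw [sum_union (disjoint_union_left.2 ⟨disjoint_union_left.2 ⟨disjoint_union_left.2 ⟨d15, d25⟩, d35⟩, d45⟩),
      sum_union (disjoint_union_left.2 ⟨disjoint_union_left.2 ⟨d14, d24⟩, d34⟩),
      sum_union (disjoint_union_left.2 ⟨d13, d23⟩), sum_union d12]
  rw [← hunion]
  exact sum_le_sum_of_subset_of_nonneg hsub fun T _ _ => hC0 T

end StarSet

end Summit.CriticalPhenomena.PercolationContinuityZ3.Theorems
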